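import Summits.QuantumAdvantage.QuantumAdvantage.Theorems.CubicForrelationNearExactIsExactZeroModSixPrep
import Summits.QuantumAdvantage.QuantumAdvantage.Theorems.CubicForrelationNearExactIsExactEighteenPairing

/-!
# Crux `CubicForrelation.NearExactIsExact` (stmt-QuantumAdvantage-14043) — `n = 6r`, TWO-SIDED: at level `2r+1` (`W_g ∈ 2^{2r+1}ℤ`, some
  `W_g/2^{2r+1}` odd) the second boundary value `Φ ≥ 1 − 2^{−2r}` is not realizable (`r ≥ 2`)

Certificate seat `b2b-cforr-cert` (gen 8).  HONEST FRAMING: a theorem uniform in `r` about cubic Boolean pairs on `6r` bits (the hyperplane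
configuration at the SECOND dyadic boundary `1 − 2^{−n/3}` on `n ≡ 0 (mod 6)`); `r = 3` is the tree's `el7_levelSeven_false`; NOT summit progress.

`z2_levelOne_false`: for cubic `f, g : 𝔽₂^{3r+3r} → 𝔽₂` with `W_g = 2^{2r+1}·u'`, some `u'(x)` odd, and `Φ(f,g) ≥ 1 − (1/2)^{2r}`: contradiction.
Proof (the `n = 18` file `…EighteenLevelSeven.lean` / the split case of `…FourModSixBoundary.lean` in general `r`): the parity `p = [u' odd]` is
AFFINE (tower); every odd point costs `≥ 4` in the budget `Σ(u − 2^r s)² = 4Σ(u' − 2^{r−1}s)² = 2^{8r+1}(1−Φ) ≤ 2^{6r+1}` (`u = 2u'`), so `p ≡ 1`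
is too expensive and `P = {u' odd}` is an affine HYPERPLANE (`2^{6r−1}` points) carrying the whole budget: `u' = 2^{r−1}s` off `P`,
`e := u' − 2^{r−1}s = ±1` on `P`.  With ONE direction `t ∉ V_P` the general 4- and 5-flat sums (`8 ∣ Σ₄ u`, `16 ∣ Σ₅ u`; Ax for `f`) localise to
`P` and give (H3)/(H4) for `e`; the engine `fl1_flat_l1` yields `(Σ|(e1_P)^|)² ≤ 2^{12r+2}`, while the pairing needs
`Σ_y (−1)^g (2e1_P)^(y) = 2^{10r}(1−Φ) = 2^{8r}`, i.e. `(2^{8r−1})² ≤ 2^{12r+2}` — false for `r ≥ 2`.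

References: J. Ax (1964) / R. J. McEliece (1972); MacWilliams–Sloane (1977) Ch. 13–15; R. O'Donnell (2014) §3.3.  Everything below is proved
from Mathlib and the tree; axioms are the standard three.
-/

set_option linter.dupNamespace false -- D-0017: single-problem summit ⇒ `QuantumAdvantage.QuantumAdvantage` by design

noncomputable section

namespace Summit.QuantumAdvantage.QuantumAdvantage.Theorems.CubicForrelation.NearExactIsExact

open Finset
open Literature.Computability.QuantumComplexity
open Literature.Computability.QuantumComplexity.BuzetChailloux (bxor zeroVec bxor_bxor_cancel_left bxor_zeroVec zeroVec_bxor bxor_comm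
  bxor_self)
open Literature.Computability.QuantumComplexity.DerivativeWalsh (W)

/-- **Level `2r+1` at the second boundary on `6r` bits is empty (`r ≥ 2`).**  For cubic `f, g : 𝔽₂^{3r+3r} → 𝔽₂` with `W_g = 2^{2r+1}·u'`,
some `u'(x)` odd and `Φ(f,g) ≥ 1 − (1/2)^{2r}`: contradiction.  Uniform in `r`; NOT summit progress. [this work] -/
theorem z2_levelOne_false (r : ℕ) (hr : 2 ≤ r) (f g : (Fin (3 * r + 3 * r) → Bool) → Bool) (hf : IsDegLeFun 3 f)
    (hg : IsDegLeFun 3 g) (u' : (Fin (3 * r + 3 * r) → Bool) → ℤ)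
    (hu' : ∀ x, W (fun y => signOf (g y)) x = (2 : ℝ) ^ (2 * r + 1) * (u' x : ℝ)) (hodd : ∃ x, Odd (u' x))
    (hΦ : 1 - (1 / 2 : ℝ) ^ (2 * r) ≤ forrelation f g) : False := by
  classical
  obtain ⟨k, rfl⟩ : ∃ k, r = k + 2 := ⟨r - 2, by omega⟩
  obtain ⟨x₁, hx₁⟩ := hodd
  -- `u = 2u'` at the Ax level `2r`
  set u : (Fin (3 * (k + 2) + 3 * (k + 2)) → Bool) → ℤ := fun x => 2 * u' x with hudef
  have hu : ∀ x, W (fun y => signOf (g y)) x = (2 : ℝ) ^ (2 * (k + 2)) * (u x : ℝ) := by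
    intro x; rw [hu' x]; simp only [u]; push_cast; ring
  -- the parity of `u'` is affine
  have hp : IsDegLeFun 1 (fun x => decide (Odd (u' x))) :=
    stub_walshTower stub_axParity (3 * (k + 2) + 3 * (k + 2)) (2 * (k + 2) + 1) 1 g u' hg hu' (by intro j hj hjn; omega)
  have hp' : IsDegLeFun (0 + 1) (fun x => decide (Odd (u' x))) := hp
  -- budget `Σ (u' − 2^{r−1} s)² ≤ 2^{6r−1}`
  have hbud := zms_budget (k + 2) f g u hu
  have hpow : (2 : ℝ) ^ (8 * (k + 2) + 1) * (1 / 2) ^ (2 * (k + 2)) = 2 ^ (6 * k + 13) := by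
    rw [one_div_pow]; field_simp; ring
  have hB0 : (∑ x, (u x - 2 ^ (k + 2) * sZ (f x)) ^ 2 : ℤ) ≤ 2 ^ (6 * k + 13) := by
    have h1 : 1 - forrelation f g ≤ (1 / 2 : ℝ) ^ (2 * (k + 2)) := by linarith
    have h' : ((∑ x, (u x - 2 ^ (k + 2) * sZ (f x)) ^ 2 : ℤ) : ℝ) ≤ (2 : ℝ) ^ (6 * k + 13) := by
      rw [hbud, ← hpow]
      exact mul_le_mul_of_nonneg_left h1 (by positivity)
    exact_mod_cast h'
  have h4 : ∀ x, (u x - 2 ^ (k + 2) * sZ (f x)) ^ 2 = 4 * (u' x - 2 ^ (k + 1) * sZ (f x)) ^ 2 := fun x => by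
    simp only [u]; ring
  have hB : (∑ x, (u' x - 2 ^ (k + 1) * sZ (f x)) ^ 2 : ℤ) ≤ 2 ^ (6 * k + 11) := by
    have h'' := hB0
    rw [sum_congr rfl fun x _ => h4 x, ← mul_sum, show (2 : ℤ) ^ (6 * k + 13) = 4 * 2 ^ (6 * k + 11) by ring] at h''
    linarith
  -- odd points cost `≥ 1`
  set P := univ.filter (fun x : Fin (3 * (k + 2) + 3 * (k + 2)) → Bool => Odd (u' x)) with hPdef
  have hmemP : ∀ x, x ∈ P ↔ Odd (u' x) := fun x => by simp [hPdef]
  have hfilt : (univ.filter fun x : Fin (3 * (k + 2) + 3 * (k + 2)) → Bool => decide (Odd (u' x)) = true) = P :=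
    filter_congr fun x _ => by simp
  have hsumP : (∑ x, (if Odd (u' x) then 1 else 0 : ℤ)) = #P := by rw [sum_boole]
  have hnonneg : ∀ x, 0 ≤ (u' x - 2 ^ (k + 1) * sZ (f x)) ^ 2 - (if Odd (u' x) then 1 else 0 : ℤ) := by
    intro x
    by_cases h : Odd (u' x)
    · rw [if_pos h]
      have hodd' : Odd (u' x - 2 ^ (k + 1) * sZ (f x)) := by
        have h2 : Even ((2 : ℤ) ^ (k + 1) * sZ (f x)) := by rw [pow_succ]; exact ⟨2 ^ k * sZ (f x), by ring⟩
        exact Int.odd_sub.2 (iff_of_true h h2)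
      have h0 := Int.odd_iff.1 hodd'
      have : u' x - 2 ^ (k + 1) * sZ (f x) ≤ -1 ∨ 1 ≤ u' x - 2 ^ (k + 1) * sZ (f x) := by omega
      have := tp_sq_ge (k := 1) (by norm_num) this
      linarith
    · rw [if_neg h]; have := sq_nonneg (u' x - 2 ^ (k + 1) * sZ (f x)); linarith
  have hPle : (#P : ℤ) ≤ 2 ^ (6 * k + 11) := by
    rw [← hsumP]
    exact le_trans (sum_le_sum fun x _ => by have := hnonneg x; linarith) hB
  have hNcard : #(univ : Finset (Fin (3 * (k + 2) + 3 * (k + 2)) → Bool)) = 2 ^ (6 * k + 12) := by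
    rw [card_univ, Fintype.card_fun, Fintype.card_bool, Fintype.card_fin]; ring
  -- the parity is not identically `1`
  have heven : ∃ x, ¬ Odd (u' x) := by
    by_contra hall
    push Not at hall
    have hPall : P = univ := filter_true_of_mem fun x _ => hall x
    rw [hPall, hNcard] at hPle
    push_cast at hPle
    have e : (2 : ℤ) ^ (6 * k + 12) = 2 * 2 ^ (6 * k + 11) := by ring
    have hpos : (0 : ℤ) < 2 ^ (6 * k + 11) := by positivity
    linarith
  obtain ⟨x₂, hx₂⟩ := heven
  -- `#P = 2^{6r−1}`: Ax with `d = 1` on the full cube gives `2·#P = 2ⁿ − 2ⁿ·z`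
  have hPcard : #P = 2 ^ (6 * k + 11) := by
    obtain ⟨z, hz⟩ := td_count_cube (le_refl 1) (fun x => decide (Odd (u' x))) hp univ
    rw [card_univ, Fintype.card_fin, show (3 * (k + 2) + 3 * (k + 2) + 1 - 1) / 1 = 6 * k + 12 by omega] at hz
    have hset : ({x : Fin (3 * (k + 2) + 3 * (k + 2)) → Bool | (∀ i, x i = true → i ∈ (univ : Finset _)) ∧
        decide (Odd (u' x)) = true} : Finset _) = P := by
      ext x; simp [hPdef]
    rw [hset] at hz
    rw [show (2 : ℤ) ^ (3 * (k + 2) + 3 * (k + 2)) = 2 ^ (6 * k + 12) by ring] at hz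
    have hPpos : (0 : ℤ) < #P := by
      have : 0 < #P := card_pos.2 ⟨x₁, (hmemP x₁).2 hx₁⟩
      exact_mod_cast this
    have hPlt : (#P : ℤ) < 2 ^ (6 * k + 12) := by
      have h1 : #P < #(univ : Finset (Fin (3 * (k + 2) + 3 * (k + 2)) → Bool)) := by
        apply card_lt_card
        exact (ssubset_iff_of_subset (filter_subset _ _)).2 ⟨x₂, mem_univ _, by simp [hx₂]⟩
      rw [hNcard] at h1
      have h2 : ((#P : ℕ) : ℤ) < ((2 ^ (6 * k + 12) : ℕ) : ℤ) := by exact_mod_cast h1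
      push_cast at h2
      exact h2
    have hX : (0 : ℤ) < 2 ^ (6 * k + 12) := by positivity
    have hz0 : z = 0 := by
      rcases lt_trichotomy z 0 with h | h | h
      · have : (2 : ℤ) ^ (6 * k + 12) * z ≤ 2 ^ (6 * k + 12) * (-1) := mul_le_mul_of_nonneg_left (by omega) hX.le
        linarith
      · exact h
      · have : (2 : ℤ) ^ (6 * k + 12) * 1 ≤ 2 ^ (6 * k + 12) * z := mul_le_mul_of_nonneg_left (by omega) hX.le
        linarith
    rw [hz0, mul_zero, sub_zero] at hz
    have : (#P : ℤ) = 2 ^ (6 * k + 11) := by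
      have e : (2 : ℤ) ^ (6 * k + 12) = 2 * 2 ^ (6 * k + 11) := by ring
      linarith
    exact_mod_cast this
  -- everything is tight
  have hsum0 : ∑ x, ((u' x - 2 ^ (k + 1) * sZ (f x)) ^ 2 - (if Odd (u' x) then 1 else 0 : ℤ)) = 0 := by
    refine le_antisymm ?_ (sum_nonneg fun x _ => hnonneg x)
    rw [sum_sub_distrib, hsumP, hPcard]
    push_cast
    linarith
  have hzero' : ∀ x, (u' x - 2 ^ (k + 1) * sZ (f x)) ^ 2 - (if Odd (u' x) then 1 else 0 : ℤ) = 0 :=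
    fun x => (sum_eq_zero_iff_of_nonneg fun y _ => hnonneg y).1 hsum0 x (mem_univ x)
  have hoff : ∀ x, ¬ Odd (u' x) → u' x - 2 ^ (k + 1) * sZ (f x) = 0 := by
    intro x hx
    have h := hzero' x
    rw [if_neg hx, sub_zero] at h
    exact (pow_eq_zero_iff two_ne_zero).1 h
  have hon : ∀ x, Odd (u' x) → u' x - 2 ^ (k + 1) * sZ (f x) = 1 ∨ u' x - 2 ^ (k + 1) * sZ (f x) = -1 := by
    intro x hx
    have h := hzero' x
    rw [if_pos hx] at h
    have h1 : (u' x - 2 ^ (k + 1) * sZ (f x)) * (u' x - 2 ^ (k + 1) * sZ (f x)) = 1 := by rw [← pow_two]; linarith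
    exact mul_self_eq_one_iff.1 h1
  have hTeq : (2 : ℝ) ^ (8 * (k + 2) + 1) * (1 - forrelation f g) = 2 ^ (6 * k + 13) := by
    have hT : (∑ x, (u x - 2 ^ (k + 2) * sZ (f x)) ^ 2 : ℤ) = 2 ^ (6 * k + 13) := by
      have e4 : ∀ x, (u x - 2 ^ (k + 2) * sZ (f x)) ^ 2 = 4 * ((u' x - 2 ^ (k + 1) * sZ (f x)) ^ 2 -
          (if Odd (u' x) then 1 else 0 : ℤ)) + 4 * (if Odd (u' x) then 1 else 0 : ℤ) := fun x => by simp only [u]; ring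
      rw [sum_congr rfl fun x _ => e4 x, sum_add_distrib, ← mul_sum, ← mul_sum, hsum0, hsumP, hPcard]
      push_cast; ring
    have h : ((∑ x, (u x - 2 ^ (k + 2) * sZ (f x)) ^ 2 : ℤ) : ℝ) = 2 ^ (6 * k + 13) := by exact_mod_cast hT
    rw [hbud] at h
    exact h
  -- `P` is a hyperplane `x₁ ⊕ V₀`
  have hmw := mw_flat_of_minweight 0 (fun x => decide (Odd (u' x))) hp' (by rw [hfilt, hPcard]; ring)
  rw [hfilt] at hmw
  obtain ⟨h0, hadd, hcardV, hcoset⟩ := hmw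
  set V₀ := univ.filter (fun a : Fin (3 * (k + 2) + 3 * (k + 2)) → Bool => ∀ x,
    decide (Odd (u' (bxor x a))) = decide (Odd (u' x))) with hV₀
  have hS : P = V₀.image (bxor x₁) := hcoset x₁ (by simpa using hx₁)
  rw [hPcard] at hcardV
  -- one transversal direction
  obtain ⟨t, -, ht⟩ := fl1_avoid univ V₀ [zeroVec] (by
    rw [List.length_singleton, hcardV, hNcard]
    have e : (2 : ℕ) ^ (6 * k + 12) = 2 * 2 ^ (6 * k + 11) := by ring
    rw [e]; have hX : 0 < 2 ^ (6 * k + 11) := Nat.two_pow_pos _; linarith)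
  have htV : t ∉ V₀ := by simpa only [zeroVec_bxor] using ht zeroVec (by simp)
  -- the sign pattern on `P` and the vanishing of the residual off `P`
  set e : (Fin (3 * (k + 2) + 3 * (k + 2)) → Bool) → ℤ := fun x => u' x - 2 ^ (k + 1) * sZ (f x) with hedef
  have he : ∀ x ∈ P, e x = 1 ∨ e x = -1 := fun x hx => hon x ((hmemP x).1 hx)
  have hpow2 : (2 : ℤ) ^ (k + 2) = 2 * 2 ^ (k + 1) := by ring
  have hF0 : ∀ y, y ∉ P → u y - 2 ^ (k + 2) * sZ (f y) = 0 := by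
    intro y hy
    have := hoff y (fun h => hy ((hmemP y).2 h))
    simp only [u]; rw [hpow2]; linarith
  have hFe : ∀ y, u y - 2 ^ (k + 2) * sZ (f y) = 2 * e y := fun y => by simp only [u, e]; rw [hpow2]; ring
  have hPV : ∀ x, x ∈ P → ∀ a ∈ V₀, bxor x a ∈ P := fun x hx a ha => fl1_coset_vadd hadd hS hx ha
  -- localisation by the single direction `t`
  have hloc : ∀ {kk : ℕ} (x : Fin (3 * (k + 2) + 3 * (k + 2)) → Bool) (a : Fin kk → Fin (3 * (k + 2) + 3 * (k + 2)) → Bool),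
      (∀ ε : Fin kk → Bool, (fun j => x j ^^ decide (Odd #(univ.filter fun i => ε i && a i j))) ∈ P) →
      ∑ ε : Fin (kk + 1) → Bool, (u (fun j => x j ^^ decide (Odd #(univ.filter fun i =>
          ε i && (Matrix.vecCons t a : Fin (kk + 1) → Fin (3 * (k + 2) + 3 * (k + 2)) → Bool) i j))) -
        2 ^ (k + 2) * sZ (f (fun j => x j ^^ decide (Odd #(univ.filter fun i =>
          ε i && (Matrix.vecCons t a : Fin (kk + 1) → Fin (3 * (k + 2) + 3 * (k + 2)) → Bool) i j))))) =
      ∑ ε : Fin kk → Bool, 2 * e (fun j => x j ^^ decide (Odd #(univ.filter fun i => ε i && a i j))) := by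
    intro kk x a hin
    have p1 := fr_sum_peel (fun y => u y - 2 ^ (k + 2) * sZ (f y)) x t a
    beta_reduce at p1
    rw [p1, sum_eq_zero fun ε _ => hF0 _ (fl1_coset_out h0 hadd hS (hin ε) htV), add_zero]
    exact sum_congr rfl fun ε _ => hFe _
  -- (H3) and (H4)
  have H3 : ∀ x ∈ P, ∀ a b c : Fin (3 * (k + 2) + 3 * (k + 2)) → Bool, a ∈ V₀ → b ∈ V₀ → c ∈ V₀ →
      (4 : ℤ) ∣ ∑ ε : Fin 3 → Bool, e (fun j => x j ^^ decide (Odd #(univ.filter fun i =>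
        ε i && (![a, b, c] : Fin 3 → Fin (3 * (k + 2) + 3 * (k + 2)) → Bool) i j))) := by
    intro x hx a b c ha hb hc
    have hin : ∀ ε : Fin 3 → Bool, (fun j => x j ^^ decide (Odd #(univ.filter fun i =>
        ε i && (![a, b, c] : Fin 3 → Fin (3 * (k + 2) + 3 * (k + 2)) → Bool) i j))) ∈ P :=
      fun ε => fr_mem_flatPt3 V₀ h0 (· ∈ P) hPV hx ![a, b, c] (fun i => by fin_cases i <;> assumption) ε
    have h8 := fs_flat_sum_dvd (e := 3) g u hg hu x ![t, a, b, c] (by omega)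
    obtain ⟨zf, hzf⟩ := sl_sum_sZ_flat f hf x ![t, a, b, c]
    have hzf' : ∑ ε : Fin 4 → Bool, 2 ^ (k + 2) * sZ (f (fun j => x j ^^ decide (Odd #(univ.filter fun i =>
          ε i && (![t, a, b, c] : Fin 4 → Fin (3 * (k + 2) + 3 * (k + 2)) → Bool) i j)))) = 8 * (2 ^ (k + 1) * zf) := by
      rw [← mul_sum, hzf]; norm_num; ring
    have h8n : (8 : ℤ) ∣ ∑ ε : Fin 4 → Bool, u (fun j => x j ^^ decide (Odd #(univ.filter fun i =>
          ε i && (![t, a, b, c] : Fin 4 → Fin (3 * (k + 2) + 3 * (k + 2)) → Bool) i j))) := by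
      have e8 : (2 : ℤ) ^ 3 = 8 := by norm_num
      rw [e8] at h8; exact h8
    have h8' : (8 : ℤ) ∣ ∑ ε : Fin 4 → Bool, (u (fun j => x j ^^ decide (Odd #(univ.filter fun i =>
          ε i && (![t, a, b, c] : Fin 4 → Fin (3 * (k + 2) + 3 * (k + 2)) → Bool) i j))) -
        2 ^ (k + 2) * sZ (f (fun j => x j ^^ decide (Odd #(univ.filter fun i =>
          ε i && (![t, a, b, c] : Fin 4 → Fin (3 * (k + 2) + 3 * (k + 2)) → Bool) i j))))) := by
      rw [sum_sub_distrib, hzf']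
      exact dvd_sub h8n (Dvd.intro _ rfl)
    rw [hloc x ![a, b, c] hin, ← mul_sum] at h8'
    obtain ⟨k8, hk8⟩ := h8'
    exact ⟨k8, by linarith⟩
  have H4 : ∀ x ∈ P, ∀ a₀ a₁ a₂ a₃ : Fin (3 * (k + 2) + 3 * (k + 2)) → Bool, a₀ ∈ V₀ → a₁ ∈ V₀ → a₂ ∈ V₀ → a₃ ∈ V₀ →
      (8 : ℤ) ∣ ∑ ε : Fin 4 → Bool, e (fun j => x j ^^ decide (Odd #(univ.filter fun i =>
        ε i && (![a₀, a₁, a₂, a₃] : Fin 4 → Fin (3 * (k + 2) + 3 * (k + 2)) → Bool) i j))) := by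
    intro x hx a₀ a₁ a₂ a₃ ha₀ ha₁ ha₂ ha₃
    have hin : ∀ ε : Fin 4 → Bool, (fun j => x j ^^ decide (Odd #(univ.filter fun i =>
        ε i && (![a₀, a₁, a₂, a₃] : Fin 4 → Fin (3 * (k + 2) + 3 * (k + 2)) → Bool) i j))) ∈ P :=
      fun ε => fr_mem_flatPt4 V₀ h0 (· ∈ P) hPV hx ![a₀, a₁, a₂, a₃] (fun i => by fin_cases i <;> assumption) ε
    have h16 := fs_flat_sum_dvd (e := 4) g u hg hu x ![t, a₀, a₁, a₂, a₃] (by omega)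
    obtain ⟨zf, hzf⟩ := sl_sum_sZ_flat f hf x ![t, a₀, a₁, a₂, a₃]
    have hzf' : ∑ ε : Fin 5 → Bool, 2 ^ (k + 2) * sZ (f (fun j => x j ^^ decide (Odd #(univ.filter fun i =>
          ε i && (![t, a₀, a₁, a₂, a₃] : Fin 5 → Fin (3 * (k + 2) + 3 * (k + 2)) → Bool) i j)))) = 16 * (2 ^ k * zf) := by
      rw [← mul_sum, hzf]; norm_num; ring
    have h16n : (16 : ℤ) ∣ ∑ ε : Fin 5 → Bool, u (fun j => x j ^^ decide (Odd #(univ.filter fun i =>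
          ε i && (![t, a₀, a₁, a₂, a₃] : Fin 5 → Fin (3 * (k + 2) + 3 * (k + 2)) → Bool) i j))) := by
      have e16 : (2 : ℤ) ^ 4 = 16 := by norm_num
      rw [e16] at h16; exact h16
    have h16' : (16 : ℤ) ∣ ∑ ε : Fin 5 → Bool, (u (fun j => x j ^^ decide (Odd #(univ.filter fun i =>
          ε i && (![t, a₀, a₁, a₂, a₃] : Fin 5 → Fin (3 * (k + 2) + 3 * (k + 2)) → Bool) i j))) -
        2 ^ (k + 2) * sZ (f (fun j => x j ^^ decide (Odd #(univ.filter fun i =>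
          ε i && (![t, a₀, a₁, a₂, a₃] : Fin 5 → Fin (3 * (k + 2) + 3 * (k + 2)) → Bool) i j))))) := by
      rw [sum_sub_distrib, hzf']
      exact dvd_sub h16n (Dvd.intro _ rfl)
    rw [hloc x ![a₀, a₁, a₂, a₃] hin, ← mul_sum] at h16'
    obtain ⟨k16, hk16⟩ := h16'
    exact ⟨k16, by linarith⟩
  -- the engine and the pairing
  have hE := fl1_flat_l1 V₀ P x₁ h0 hadd hS e he H3 H4
  set A : (Fin (3 * (k + 2) + 3 * (k + 2)) → Bool) → ℝ := fun x => if x ∈ P then (e x : ℝ) else 0 with hA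
  have hAτ : (fun x => (u x : ℝ) - (2 : ℝ) ^ (k + 2) * signOf (f x)) = fun x => 2 * A x := by
    funext x
    have h2 : (u x : ℝ) - (2 : ℝ) ^ (k + 2) * signOf (f x) = (((u x - 2 ^ (k + 2) * sZ (f x) : ℤ)) : ℝ) := by
      push_cast; rw [tp_sZ_cast]
    rw [h2]
    by_cases hx : x ∈ P
    · simp only [A, if_pos hx]; rw [hFe x]; push_cast; ring
    · simp only [A, if_neg hx]; rw [hF0 x hx]; norm_num
  have hpair := zms_pairing (k + 2) f g u hu
  rw [hAτ] at hpair
  have hpair' : ∑ y, signOf (g y) * W A y = (2 : ℝ) ^ (8 * k + 15) := by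
    have e2 : ∀ y, signOf (g y) * W (fun x => 2 * A x) y = 2 * (signOf (g y) * W A y) := fun y => by
      rw [fl1_W_smul]; ring
    rw [sum_congr rfl fun y _ => e2 y, ← mul_sum,
      show (2 : ℝ) ^ (10 * (k + 2)) = 2 ^ (2 * k + 3) * 2 ^ (8 * (k + 2) + 1) by ring, mul_assoc, hTeq] at hpair
    have e3 : (2 : ℝ) ^ (2 * k + 3) * 2 ^ (6 * k + 13) = 2 * 2 ^ (8 * k + 15) := by ring
    rw [e3] at hpair
    linarith
  have hge : (2 : ℝ) ^ (8 * k + 15) ≤ ∑ y, |W A y| := by rw [← hpair']; exact fl1_pairing_le_l1 g (W A)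
  have hsq : ((2 : ℝ) ^ (8 * k + 15)) ^ 2 ≤ (∑ y, |W A y|) ^ 2 := pow_le_pow_left₀ (by positivity) hge 2
  have hEn : (∑ y, |W A y|) ^ 2 ≤ (2 : ℝ) ^ (12 * k + 26) := by
    refine hE.trans (le_of_eq ?_)
    rw [show (3 * (k + 2) + 3 * (k + 2)) = 6 * k + 12 by ring]
    ring
  have hbig : (2 : ℝ) ^ (12 * k + 26) < ((2 : ℝ) ^ (8 * k + 15)) ^ 2 := by
    have e2 : ((2 : ℝ) ^ (8 * k + 15)) ^ 2 = 2 ^ (12 * k + 26) * 2 ^ (4 * k + 4) := by ring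
    rw [e2]
    have h1 : (1 : ℝ) < 2 ^ (4 * k + 4) := one_lt_pow₀ (by norm_num) (by omega)
    have h2 : (0 : ℝ) < 2 ^ (12 * k + 26) := by positivity
    exact lt_mul_of_one_lt_right h2 h1
  linarith

end Summit.QuantumAdvantage.QuantumAdvantage.Theorems.CubicForrelation.NearExactIsExact

end
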